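import Summits.CriticalPhenomena.PercolationContinuityZ3.Theorems.Transplant.PlanarSkeletonFrmScaledDefs
import Summits.CriticalPhenomena.PercolationContinuityZ3.Theorems.Transplant.SkelPhiQStepsNMaps
import Summits.CriticalPhenomena.PercolationContinuityZ3.Theorems.Transplant.SkelPhiPsiStepsCriticalProb
import HarnessLib

/-!
# The QUASI-STEP carrier `PlanarSkeletonFrmQuasi` (interface of the (N3-b) rung, design owner's R2 proposal in the form fixed by the refuter's R2′ verdict):
# `PlanarSkeletonFrmFrom` with the single-edge step field (ι) replaced by EXACT-FOOTPRINT QUASI-STEPS `Skelφ.QStepsN G φ M` and the cylinder field (κ′)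
# replaced by (κ″) «joined inside a `W`-fattening»; its cylinders and cylinder hypothesis, the forgetful map from `PlanarSkeletonFrmFrom`, `p_c < 1`

builds on p205010 (kernel theorem, internal audit signed; external expert review pending) — nothing in this file uses p205010; NO `@[conjecture]` is declared and nothing
is claimed about any open node: this is the CARRIER (a structure and its dictionary) the quasi-step node would quantify over; the node's statement, name and wording are
the lead's / the planners'.  Lane `prim-bschramm`, seat `prim-bschramm-p3` gen 29 (DESIGN OWNER; N3B-RUNG §3/R2; WAVE-Q-MANIFEST v0.3 §9; refuter p5-g28's
R2′ verdict F1–F3, lane INBOX 2026-08-27 05:49Z/05:58Z; design owner's reversal 06:01Z).  Helper file (`--supports stmt-CriticalPhenomena-4575 --as helper`).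

DESIGN (one scale, no `N`/`L`/fine units).  The fields are those of `PlanarSkeletonFrmFrom` (p486426's carrier: `1`-Lipschitz integer chart, finitely many
types with translating frames, a degree bound) except: (ι_M) `qstep : Skelφ.QStepsN G φ M` — every unit move of the chart is realised by a walk of length
`≤ M` whose vertices are AT the start value or equal to the far end (the exact START footprint the Kozma–Nitzan kit layer needs at the contact layer —
«SkelSeedKit» `KitOK.S_sub`; the two-sided `InHull` footprint of `Skelφ.PsiSteps` does NOT suffice); (κ″) `cyl_reach` — two vertices of the cylinder of
half-width `ℓ ≥ ℓ₀` at a base vertex are joined INSIDE the cylinder of half-width `ℓ + W` (what the orbit construction delivers; induced connectivity of the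
cylinder itself can fail under quasi-steps).  Regression: `PlanarSkeletonFrmFrom.toFrmQuasi` (`M = 1`, `W = 0`, `Skelφ.qStepsN_of_steps`).  Customer side:
the refuter's TREE CHART («AutChartTreeTransversal»/«AutChartTreeChart», p504432/p505265: every action with finitely many orbits and a rank-two character
killing the stabilisers carries a coarse chart with `Skelφ.Lip` + `Skelφ.QStepsN`; coarse frames + (κ″) in its sequel).
* §1 the structure; `cyl`, `cyl_mono`, **`CylSubcritical`** (Φ2: `θ = 0` at `p` on every induced cylinder at a base vertex — the hypothesis `hC` of the
  hC-node; for class C2 it discharges itself by induction on the growth degree, «AutCylinderInduction» p505788); the fields `frame`/`lip` ARE the LEVEL-0 predicates `Skelφ.Frames`/`Skelφ.Lip`;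
  `psiSteps` (via gen-1 g4's `Skelφ.psiSteps_of_qStepsN`, «SkelPhiQStepsNMaps»), `isQuasiTransitive_frmQuasi`, **`criticalProb_lt_one_frmQuasi`**
  (step-free `p_c < 1` from frames + quasi-steps, gen-1 g4's γ1 `Skelφ.criticalProb_lt_one_of_frames_psiSteps`);
* §2 `PlanarSkeletonFrmFrom.toFrmQuasi` + `toFrmQuasi_types/φ/cyl`, `cylSubcritical_toFrmQuasi_iff`.
[cite: KozmaNitzan2024, §4 p. 16 (Lemma 8), p. 19 (Step III)] [cite: MartineauTassion2017, §3.2] [cite: BenjaminiSchramm1996, Conj. 4; §2 (almost transitive graphs)]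
[cite: MartineauSevero2019, Cor. 2.2]
-/

noncomputable section

namespace Summit.CriticalPhenomena.PercolationContinuityZ3.Theorems.Transplant

open MeasureTheory Literature.Probability.Percolation Literature.Probability.LatticeModels SimpleGraph
open Literature.Barriers.CriticalPhenomena (IsQuasiTransitive countable_of_connected_of_locallyFinite)
open scoped Classical

/-! ## §1 The carrier -/

/-- **Planar skeleton with translating frames, a `1`-Lipschitz integer chart, EXACT-FOOTPRINT QUASI-STEPS of cost `M`, and cylinders joined inside a
`W`-fattening from some width on** — the quasi-step carrier of the (N3-b) rung: `PlanarSkeletonFrmFrom` with (ι) ↦ (ι_M) `Skelφ.QStepsN G φ M` and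
(κ′) ↦ (κ″). [cite: KozmaNitzan2024, §4 p. 16 (Lemma 8), p. 19 (Step III)] [cite: MartineauTassion2017, §3.2] -/
structure PlanarSkeletonFrmQuasi {V : Type} (G : SimpleGraph V) [G.LocallyFinite] where
  /-- the skeleton map `φ : V → ℤ²` (one scale) -/
  φ : V → Site 2
  /-- `φ` is `1`-Lipschitz in the sup-norm along edges -/
  lip : ∀ ⦃u v : V⦄, G.Adj u v → ∀ i : Fin 2, |φ u i - φ v i| ≤ 1
  /-- finitely many base vertices (one per frame type) -/
  types : Finset V
  /-- FRAMES: every vertex is the image of a base vertex under an automorphism translating the skeleton -/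
  frame : ∀ v : V, ∃ t ∈ types, ∃ α : G ≃g G, α t = v ∧ ∀ w, φ (α w) = φ w + (φ v - φ t)
  /-- (μ) a degree bound -/
  Δ : ℕ
  /-- every vertex has degree `≤ Δ` -/
  degree_le : ∀ v : V, G.degree v ≤ Δ
  /-- the quasi-step cost -/
  M : ℕ
  /-- (ι_M) EXACT-FOOTPRINT QUASI-STEPS: every unit move of `φ` in each of the four directions is realised by a walk of length `≤ M` all of whose
  vertices are at the start value of `φ` or equal to the far end -/
  qstep : Skelφ.QStepsN G φ M
  /-- (κ″) the width from which on cylinders are joined inside their fattening -/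
  ℓ₀ : ℕ
  /-- (κ″) the fattening -/
  W : ℕ
  /-- (κ″) any two vertices of the cylinder of half-width `ℓ ≥ ℓ₀` at a base vertex are joined inside the cylinder of half-width `ℓ + W` -/
  cyl_reach : ∀ t ∈ types, ∀ ℓ : ℕ, ℓ₀ ≤ ℓ → ∀ u v : V, φ u - φ t ∈ box 2 ℓ → φ v - φ t ∈ box 2 ℓ →
    ∃ (hu : u ∈ {w | φ w - φ t ∈ box 2 (ℓ + W)}) (hv : v ∈ {w | φ w - φ t ∈ box 2 (ℓ + W)}),
      (G.induce {w | φ w - φ t ∈ box 2 (ℓ + W)}).Reachable ⟨u, hu⟩ ⟨v, hv⟩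

namespace PlanarSkeletonFrmQuasi

variable {V : Type} {G : SimpleGraph V} [G.LocallyFinite] (Φ : PlanarSkeletonFrmQuasi G)

/-- Cylinder of half-width `ℓ` at `t`. [cite: KozmaNitzan2024, §4 p. 15 (boxes)] -/
def cyl (t : V) (ℓ : ℕ) : Set V := {w | Φ.φ w - Φ.φ t ∈ box 2 ℓ}

/-- Cylinders grow with the half-width. [folklore] -/
theorem cyl_mono (t : V) {ℓ ℓ' : ℕ} (h : ℓ ≤ ℓ') : Φ.cyl t ℓ ⊆ Φ.cyl t ℓ' := fun _ hw => box_mono 2 h hw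

/-- **Input Φ2 at density `p` (the hypothesis `hC` of the hC-node)**: the induced graph of every cylinder (EVERY width) at a base vertex has `θ = 0` at `p`.
For class C2 it discharges itself by induction on the growth degree («AutCylinderInduction»). [cite: MartineauSevero2019, Cor. 2.2] -/
def CylSubcritical (p : unitInterval) : Prop :=
  ∀ t ∈ Φ.types, ∀ ℓ : ℕ,
    theta (G.induce (Φ.cyl t ℓ)) ⟨t, show Φ.φ t - Φ.φ t ∈ box 2 ℓ by rw [sub_self]; exact zero_mem_box 2 ℓ⟩ p = 0

/-- (κ″) read through `cyl`: two vertices of `cyl t ℓ`, `ℓ ≥ ℓ₀`, are joined inside `cyl t (ℓ + W)`. [folklore] -/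
theorem cyl_reach' {t : V} (ht : t ∈ Φ.types) {ℓ : ℕ} (hℓ : Φ.ℓ₀ ≤ ℓ) {u v : V} (hu : u ∈ Φ.cyl t ℓ) (hv : v ∈ Φ.cyl t ℓ) :
    ∃ (hu' : u ∈ Φ.cyl t (ℓ + Φ.W)) (hv' : v ∈ Φ.cyl t (ℓ + Φ.W)), (G.induce (Φ.cyl t (ℓ + Φ.W))).Reachable ⟨u, hu'⟩ ⟨v, hv'⟩ :=
  Φ.cyl_reach t ht ℓ hℓ u v hu hv

/-- The quasi-steps have the `InHull` footprint as well (`Skelφ.PsiSteps G φ M`). [folklore] -/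
theorem psiSteps : Skelφ.PsiSteps G Φ.φ Φ.M := Skelφ.psiSteps_of_qStepsN Φ.qstep

/-- Frames with finitely many types make a `PlanarSkeletonFrmQuasi` graph quasi-transitive. [cite: Hutchcroft2016, §1 (finitely many Aut(G)-orbits)] -/
theorem isQuasiTransitive_frmQuasi (Φ : PlanarSkeletonFrmQuasi G) : IsQuasiTransitive G :=
  ⟨Φ.types, fun v => by
    obtain ⟨t, ht, α, hαt, -⟩ := Φ.frame v
    exact ⟨α.symm, by rw [← hαt, RelIso.symm_apply_apply]; exact ht⟩⟩

/-- **`p_c < 1` at every vertex of a connected `PlanarSkeletonFrmQuasi` graph — STEP-FREE** (frames + quasi-steps: gen-1 g4's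
`Skelφ.criticalProb_lt_one_of_frames_psiSteps`). [cite: BenjaminiSchramm1996, Thm. 1; §2 Conj. 1] -/
theorem criticalProb_lt_one_frmQuasi (Φ : PlanarSkeletonFrmQuasi G) (hc : G.Connected) (v : V) : criticalProb G v < 1 :=
  Skelφ.criticalProb_lt_one_of_frames_psiSteps (types := Φ.types) hc Φ.frame Φ.psiSteps v

end PlanarSkeletonFrmQuasi

/-! ## §2 The forgetful map from `PlanarSkeletonFrmFrom` -/

namespace PlanarSkeletonFrmFrom

variable {V : Type} {G : SimpleGraph V} [G.LocallyFinite] (Φ : PlanarSkeletonFrmFrom G)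

/-- **Every `PlanarSkeletonFrmFrom` is a `PlanarSkeletonFrmQuasi`** with `M = 1` (single-edge steps are exact-footprint quasi-steps of cost `1`) and `W = 0`
(connected cylinders join their vertices inside themselves). [folklore] -/
def toFrmQuasi : PlanarSkeletonFrmQuasi G where
  φ := Φ.φ
  lip := Φ.lip
  types := Φ.types
  frame := Φ.frame
  Δ := Φ.Δ
  degree_le := Φ.degree_le
  M := 1
  qstep := Skelφ.qStepsN_of_steps Φ.step
  ℓ₀ := Φ.ℓ₀
  W := 0
  cyl_reach := fun t ht ℓ hℓ u v hu hv => ⟨hu, hv, (Φ.cyl_connected t ht ℓ hℓ).preconnected ⟨u, hu⟩ ⟨v, hv⟩⟩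

/-- The chart of `toFrmQuasi` is that of the skeleton. [folklore] -/
@[simp] theorem toFrmQuasi_φ : Φ.toFrmQuasi.φ = Φ.φ := rfl

/-- The base vertices of `toFrmQuasi` are those of the skeleton. [folklore] -/
@[simp] theorem toFrmQuasi_types : Φ.toFrmQuasi.types = Φ.types := rfl

/-- The cylinders of `toFrmQuasi` are those of the skeleton. [folklore] -/
@[simp] theorem toFrmQuasi_cyl (t : V) (ℓ : ℕ) : Φ.toFrmQuasi.cyl t ℓ = Φ.cyl t ℓ := rfl

/-- Cylinder subcriticality is the same statement for `toFrmQuasi`. [folklore] -/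
theorem cylSubcritical_toFrmQuasi_iff (p : unitInterval) : Φ.toFrmQuasi.CylSubcritical p ↔ Φ.CylSubcritical p := Iff.rfl

end PlanarSkeletonFrmFrom

end Summit.CriticalPhenomena.PercolationContinuityZ3.Theorems.Transplant

end
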